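import Summits.ResolutionOfSingularities.ResolutionOfSingularities.Theorems.PurelyInseparableDim4ResConeRotationReadings
import Summits.ResolutionOfSingularities.ResolutionOfSingularities.Theorems.PurelyInseparableDim4ResConeTwoSlotRelabelChain
import Summits.ResolutionOfSingularities.ResolutionOfSingularities.Theorems.PurelyInseparableDim4ResConeTwoSlotLetters
import Summits.ResolutionOfSingularities.ResolutionOfSingularities.Theorems.PurelyInseparableDim4ResConeTwoSlotTailL
import Summits.ResolutionOfSingularities.ResolutionOfSingularities.Theorems.PurelyInseparableDim4ResConeTwoSlotGameRotating
import HarnessLib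
import HarnessLib.Audit.Tags

/-!
# Purely inseparable four-folds — THE TWO-SLOT A∞ TAIL IS EMPTY, ROTATIONS INCLUDED; K27a's light `d = 3` tail at
# `p = 5` is empty UNCONDITIONALLY (cell `res-dim4-pi`, K2(p) lane, slice B brick K24a, part γ″, file 3 = assembly)

[OURS · counted 0 · cell `res-dim4-pi` · K2(p) lane (holder res-dim4-p-12; «p-1 takes K24a» 2026-08-29 01:14Z;
R1′(β) 04:06Z); seat res-dim4-p-1 g4 over: its rotating reading game γ₀‴ `no_twoSlot_tail_of_readings_rotating`, the
one-step packages `slot_step_readings_chain` (β4-S) / `slot_step_relabel_chain` / `rotation_step_readings_chain`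
(R1c, through res-dim4-p-7 g4's graded unit-class transfer), the letter bookkeeping `twoSlot_letters`, res-dim4-p-2
g5's L-sector kill `no_twoSlot_tail_five_L`, and res-dim4-p-3's K27a `no_light_powerCone_tail_three_five_of`.]
Nothing here proves K2(p)/K2(5), `NoIsolatedTrap p p` or resolution of singularities in dimension ≥ 4 /
characteristic `p`.  AI kernel work, weaker than expert review.

* **`no_twoSlot_tail_five`** — the (T2) configuration of the light `d = 3` tail at `p = 5` (idle boundary letter
  `ν` from `k₁ ≥ k₀` on, the other boundary letters stretch-born) is contradictory on a witnessed isolated above-floor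
  `Step0 5` chain of shade `3`, `e_G = 3` — NO residual hypothesis (slot steps AND rotations; T- and L-sector).
  Route: K27a's weights `≤ 1` (else a free tail, ✗ FT); at every `k ≥ k₁` the vertex form charges the free letter
  (else res-dim4-p-2's `no_twoSlot_tail_five_L` at `k`); letters `A_m, B_m, Y_m` by `twoSlot_letters`; canonical
  frames at `Y_m` (β1); the readings `s, t` of `clean (τ_{Φ_m} F_m)`; the eight laws of γ₀‴ from the slot-step and
  rotation-step packages; γ₀‴.
* **`no_light_powerCone_tail_three_five`** — K27a with `hT2` discharged: a witnessed isolated above-floor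
  `Step0 5` chain with `x^{r₀} ∣ F₀` has no tail of shade `3` and `e_G = 3`.  UNCONDITIONAL at `d = 3`, `p = 5`.

[cite: CossartJannsenSaito2020, Thm. 3.10(4), Thm. 3.14, Thm. 9.3] [cite: Hauser2010, §6]
bears_on: LADDER-RESOLUTION:D157-DOOR2 (res-dim4-pi · K2(p) · slice B · K24a CLOSED at d = 3, p = 5).  Supports
stmt-ResolutionOfSingularities-16155 (helper).
-/

set_option linter.dupNamespace false -- mandated namespace of this single-conjunct summit

noncomputable section

namespace Summit.ResolutionOfSingularities.ResolutionOfSingularities.Theorems.PIDim4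

namespace ResCone

open MvPolynomial Finset FrameChange
open Literature.AlgebraicGeometry.Resolution
open Literature.AlgebraicGeometry.Resolution.CentreBlowup
open Literature.AlgebraicGeometry.Resolution.Hauser2010
open Literature.AlgebraicGeometry.Resolution.HauserPerlega2019

variable {K : Type} [Field K]

section Tail

variable [CharP K 5] [DecidableEq K]

-- One assembly over four step kinds × twelve laws of the reading game: the default budget does not suffice.
set_option maxHeartbeats 400000 in
/-- **THE TWO-SLOT A∞ TAIL IS EMPTY, ROTATIONS INCLUDED** (K24a; statement and route in the module docstring).
[OURS] [cite: CossartJannsenSaito2020, Thm. 3.14, Thm. 9.3] -/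
theorem no_twoSlot_tail_five {c : ℕ → State K} {j : ℕ → Fin 4} {b : ℕ → Fin 4 → K}
    (hc : ∀ k, IsIsolated 5 (c k).F ∧ Step0 5 (c k) (c (k + 1))) (hw : FreeTail.IsWitnessedChain 5 c j b)
    (hr0 : ∀ e ∈ (c 0).F.support, (c 0).r ≤ e) (hfloor : ∀ k, ordZero (c k).F ≠ (5 : ℕ)) {k₀ : ℕ}
    (hshade : ∀ k, k₀ ≤ k → (c k).shade = ((3 : ℕ) : ℕ∞))
    (he3 : ∀ k, k₀ ≤ k → Module.finrank K (resVertex (c k)) = 3) {ν : Fin 4} {k₁ : ℕ} (hk₁ : k₀ ≤ k₁)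
    (hidle : ∀ k, k₁ ≤ k → 1 ≤ (c k).r ν ∧ j k ≠ ν ∧ b k ν = 0)
    (hborn : ∀ k, k₁ ≤ k → ∀ i, i ≠ ν → 1 ≤ (c k).r i →
      ∃ t, k₀ ≤ t ∧ t < k ∧ j t = i ∧ ∀ m, t < m → m < k → j m ≠ i ∧ b m i = 0) :
    False := by
  haveI : Fact (Nat.Prime 5) := ⟨by norm_num⟩
  have h3K : (3 : K) ≠ 0 := fun h =>
    absurd ((CharP.cast_eq_zero_iff K 5 3).mp (by exact_mod_cast h)) (by norm_num)
  -- the frame data of the power-cone stretch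
  obtain ⟨ℓ, a0, lam, hpkg⟩ := chain_powerCone_package 5 hc hw hr0 hfloor (by norm_num) hshade he3
  have hV : ∀ k, k₀ ≤ k → ∀ w, w ∈ resVertex (c k) ↔ dotProduct (ℓ k) w = 0 := fun k hk => (hpkg k hk).2.1
  have hform : ∀ k, k₀ ≤ k → resForm (c k) = C (a0 k) * (∑ i, C (ℓ k i) * X i) ^ 3 :=
    fun k hk => (hpkg k hk).2.2.1
  have hdir : ∀ k, k₀ ≤ k → ℓ k (j k) + dotProduct (ℓ k) (b k) = 0 := fun k hk => (hpkg k hk).2.2.2.1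
  have hlam : ∀ k, k₀ ≤ k → lam k ≠ 0 := fun k hk => (hpkg k hk).2.2.2.2.1
  have hprop : ∀ k, k₀ ≤ k → ∀ i, i ≠ j k → ℓ (k + 1) i = lam k * ℓ k i :=
    fun k hk => (hpkg k hk).2.2.2.2.2.1
  have hcarry : ∀ k, k₀ ≤ k → ∃ i, i ≠ j k ∧ ℓ k i ≠ 0 := fun k hk => (hpkg k hk).2.2.2.2.2.2
  -- K27a's weights: free tail (✗ FT) or weights `≤ 1` with `|r| = 3`
  have hlight : ∀ k, k₀ ≤ k → FreeTail.IsSatellite j b k → ∀ oₖ oₖ₁ : ℕ,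
      ordZero (c k).F = oₖ → ordZero (c (k + 1)).F = oₖ₁ → oₖ + oₖ₁ + 3 ≤ 15 := by
    intro k hk hsat oₖ oₖ₁ hoₖ hoₖ₁
    have h := satellite_light_of_powerCone 5 hc hw hr0 hfloor (by norm_num) (by norm_num) hshade hform hdir hlam
      hprop hcarry hk hsat hoₖ hoₖ₁
    omega
  have hfloor' : ∀ k, ordZero (c k).F ≠ 5 := fun k => by have h := hfloor k; exact_mod_cast h
  have hFT : ∀ k₂, (∀ k, k₂ ≤ k → ¬ FreeTail.IsSatellite j b k) → False := fun k₂ hfree => by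
    obtain ⟨k, hk⟩ := FreeTailProof.noIsolatedFreeTailAt_self 5 K c j b k₂ hw hfree
    exact hk (hc k).1
  rcases light_weights hc hw hfloor' hshade hlight with ⟨k₂, -, hfree⟩ | hwt
  · exact hFT k₂ hfree
  have hord : ∀ k, k₀ ≤ k → ordZero (c k).F = ((6 : ℕ) : ℕ∞) := by
    intro k hk
    obtain ⟨o, ho, -, -, hod⟩ := chain_shade_nat 5 hc hfloor hshade hk
    rw [ho, (hwt k hk).2] at *
    have : o = 6 := by omega
    rw [this]
  have hdivk := IsolatedBand.isolated_chain_forall_le hc hr0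
  have ha0 : ∀ k, k₀ ≤ k → a0 k ≠ 0 := fun k hk => ne_zero_of_resForm_eq_C_mul (hord k hk) (hdivk k) (hform k hk)
  -- the vertex form charges the free letter at every stage (else the L-sector theorem)
  have hTk : ∀ k, k₁ ≤ k → ∀ i, (c k).r i = 0 → ℓ k i ≠ 0 := fun k hk i hri hℓi =>
    no_twoSlot_tail_five_L hc hw hr0 hfloor hshade he3 (hk₁.trans hk) (fun k' hk' => hidle k' (hk.trans hk'))
      ⟨ℓ k, hV k (hk₁.trans hk), i, hri, hℓi⟩
  -- clean from `k₁ + 1` on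
  set k₂ := k₁ + 1 with hk₂
  have hclean : ∀ k, k₂ ≤ k → deletePthPowers 5 (c k).F = (c k).F := by
    intro k hk
    obtain ⟨k', rfl⟩ : ∃ k', k = k' + 1 := ⟨k - 1, by omega⟩
    rw [(hw k').2.2.2.2]
    exact deletePthPowers_step_F 5 Finset.univ (j k') (b k') (c k')
  have hk₂m : ∀ m, k₁ ≤ k₂ + m := fun m => by omega
  have hk₀m : ∀ m, k₀ ≤ k₂ + m := fun m => by omega
  -- the letters
  obtain ⟨A, B, Y, L, hLet⟩ := twoSlot_letters 5 hw (k₂ := k₂) (fun k hk => hord k (by omega))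
    (fun k hk => hwt k (by omega)) (fun k hk => hidle k (by omega))
  have hdist := fun m => (hLet m).1
  have hr := fun m => (hLet m).2.1
  have hcls := fun m => (hLet m).2.2
  have hq := fun m => triple_apply (hdist m).1 (hdist m).2.1 (hdist m).2.2.1 (hdist m).2.2.2.1 (hdist m).2.2.2.2.1
    (hdist m).2.2.2.2.2
  have hrY : ∀ m, (c (k₂ + m)).r (Y m) = 0 := fun m => by rw [hr m]; exact (hq m).2.2.2
  have hℓY : ∀ m, ℓ (k₂ + m) (Y m) ≠ 0 := fun m => hTk _ (hk₂m m) _ (hrY m)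
  have hbornA : ∀ m, ∃ t, k₀ ≤ t ∧ t < k₂ + m ∧ j t = A m ∧ ∀ m', t < m' → m' < k₂ + m → j m' ≠ A m ∧ b m' (A m) = 0 :=
    fun m => hborn _ (hk₂m m) (A m) (hdist m).2.1 (by rw [hr m, (hq m).1])
  have hbornB : ∀ m, ∃ t, k₀ ≤ t ∧ t < k₂ + m ∧ j t = B m ∧ ∀ m', t < m' → m' < k₂ + m → j m' ≠ B m ∧ b m' (B m) = 0 :=
    fun m => hborn _ (hk₂m m) (B m) (hdist m).2.2.2.1 (by rw [hr m, (hq m).2.1])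
  -- a canonical frame of order `7` at the free letter of every stage (β1)
  have hframe : ∀ m, ∃ φ : MvPolynomial (Fin 4) K, constantCoeff φ = 0 ∧ Y m ∉ φ.vars ∧
      (∀ i, i ≠ Y m → coeff (Finsupp.single i 1) φ = -(ℓ (k₂ + m) i / ℓ (k₂ + m) (Y m))) ∧
      homogeneousComponent 3 (tsch (Y m) φ ((c (k₂ + m)).F.divMonomial (c (k₂ + m)).r)) =
        C (a0 (k₂ + m) * ℓ (k₂ + m) (Y m) ^ 3) * X (Y m) ^ 3 ∧
      ∀ n : Fin 4 →₀ ℕ, n (Y m) = 2 → n.degree ≤ 9 →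
        coeff n (tsch (Y m) φ ((c (k₂ + m)).F.divMonomial (c (k₂ + m)).r)) = 0 := by
    intro m
    obtain ⟨φ, h0, hv, hlin, h3, hN⟩ := FrameChange.exists_canonical_frame_state (Y m) (d := 3) (by norm_num) h3K
      (hord _ (hk₀m m)) (hdivk _) (by rw [hr m, degree_triple]) (ha0 _ (hk₀m m)) (hℓY m) (hform _ (hk₀m m)) 7
    exact ⟨φ, h0, hv, hlin, h3, fun n hnf hn => hN n (by rw [hnf]) (by omega)⟩
  choose Φ h0Φ hΦv hΦlin hΦ3 hΦN using hframe
  -- the readings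
  set sR : ℕ → ℕ → ℕ → ℕ → K := fun m x y z =>
    coeff ((c (k₂ + m)).r + (Finsupp.single (A m) (x + 1) + Finsupp.single (B m) (y + 1) + Finsupp.single ν z))
      (deletePthPowers 5 (tsch (Y m) (Φ m) (c (k₂ + m)).F)) with hsR
  set tR : ℕ → ℕ → ℕ → ℕ → K := fun m x y z =>
    coeff ((c (k₂ + m)).r + (Finsupp.single (Y m) 1 + Finsupp.single (A m) (x + 1) + Finsupp.single (B m) (y + 1) +
      Finsupp.single ν z)) (deletePthPowers 5 (tsch (Y m) (Φ m) (c (k₂ + m)).F)) with htR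
  -- the four one-step packages
  have PA := fun m (hj : j (k₂ + m) = A m) (hb : b (k₂ + m) = Pi.single (Y m) (b (k₂ + m) (Y m)))
      (hA' : A (m + 1) = A m) (hB' : B (m + 1) = B m) (hY' : Y (m + 1) = Y m) =>
    slot_step_readings_chain hc hw hr0 hfloor hshade hord hform hdir hlam hprop hcarry (k := k₂ + m) (hk₀m m)
      (hdist m).1 (hdist m).2.1 (hdist m).2.2.1 (hdist m).2.2.2.1 (hdist m).2.2.2.2.1 (hdist m).2.2.2.2.2 (hr m) rfl
      (by have h := hr (m + 1); rw [hA', hB'] at h; rw [hr m]; exact h) hj hb (hℓY m)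
      (hclean _ (Nat.le_add_right _ _)) (he3 _ (hk₀m (m + 1))) (hbornA m) (hbornB m) (hΦv m) (h0Φ m)
      (hΦlin m (A m) (hdist m).2.2.1) (hΦ3 m) (hΦN m) (ψ := Φ (m + 1)) (hY' ▸ hΦv (m + 1)) (h0Φ (m + 1))
      (a' := a0 (k₂ + (m + 1)) * ℓ (k₂ + (m + 1)) (Y m) ^ 3) (by have h := hΦ3 (m + 1); rw [hY'] at h; exact h)
      (by have h := hΦN (m + 1); rw [hY'] at h; exact h)
  have QA := fun m (hj : j (k₂ + m) = A m) (hb : b (k₂ + m) = Pi.single (Y m) (b (k₂ + m) (Y m)))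
      (hY' : Y (m + 1) = Y m) =>
    slot_step_relabel_chain hc hw hr0 hord hform hdir (k := k₂ + m) (hk₀m m) (hdist m).1 (hdist m).2.1
      (hdist m).2.2.1 (hdist m).2.2.2.1 (hdist m).2.2.2.2.1 (hdist m).2.2.2.2.2 (hr m) rfl hj hb (hℓY m)
      (hclean _ (Nat.le_add_right _ _)) (he3 _ (hk₀m (m + 1))) (hΦv m) (h0Φ m) (hΦlin m (A m) (hdist m).2.2.1)
      (hΦ3 m) (hΦN m) (ψ := Φ (m + 1)) (hY' ▸ hΦv (m + 1)) (h0Φ (m + 1))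
      (a' := a0 (k₂ + (m + 1)) * ℓ (k₂ + (m + 1)) (Y m) ^ 3) (by have h := hΦ3 (m + 1); rw [hY'] at h; exact h)
      (by have h := hΦN (m + 1); rw [hY'] at h; exact h)
  have hrBA : ∀ m, (c (k₂ + m)).r = Finsupp.single (B m) 1 + Finsupp.single (A m) 1 + Finsupp.single ν 1 :=
    fun m => by rw [hr m, add_comm (Finsupp.single (A m) 1)]
  have PB := fun m (hj : j (k₂ + m) = B m) (hb : b (k₂ + m) = Pi.single (Y m) (b (k₂ + m) (Y m)))
      (hA' : A (m + 1) = A m) (hB' : B (m + 1) = B m) (hY' : Y (m + 1) = Y m) =>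
    slot_step_readings_chain hc hw hr0 hfloor hshade hord hform hdir hlam hprop hcarry (k := k₂ + m) (hk₀m m)
      (hdist m).1.symm (hdist m).2.2.2.1 (hdist m).2.2.2.2.1 (hdist m).2.1 (hdist m).2.2.1 (hdist m).2.2.2.2.2
      (hrBA m) rfl (by have h := hrBA (m + 1); rw [hA', hB'] at h; rw [hrBA m]; exact h) hj hb (hℓY m)
      (hclean _ (Nat.le_add_right _ _)) (he3 _ (hk₀m (m + 1))) (hbornB m) (hbornA m) (hΦv m) (h0Φ m)
      (hΦlin m (B m) (hdist m).2.2.2.2.1) (hΦ3 m) (hΦN m) (ψ := Φ (m + 1)) (hY' ▸ hΦv (m + 1)) (h0Φ (m + 1))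
      (a' := a0 (k₂ + (m + 1)) * ℓ (k₂ + (m + 1)) (Y m) ^ 3) (by have h := hΦ3 (m + 1); rw [hY'] at h; exact h)
      (by have h := hΦN (m + 1); rw [hY'] at h; exact h)
  have QB := fun m (hj : j (k₂ + m) = B m) (hb : b (k₂ + m) = Pi.single (Y m) (b (k₂ + m) (Y m)))
      (hY' : Y (m + 1) = Y m) =>
    slot_step_relabel_chain hc hw hr0 hord hform hdir (k := k₂ + m) (hk₀m m) (hdist m).1.symm (hdist m).2.2.2.1
      (hdist m).2.2.2.2.1 (hdist m).2.1 (hdist m).2.2.1 (hdist m).2.2.2.2.2 (hrBA m) rfl hj hb (hℓY m)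
      (hclean _ (Nat.le_add_right _ _)) (he3 _ (hk₀m (m + 1))) (hΦv m) (h0Φ m) (hΦlin m (B m) (hdist m).2.2.2.2.1)
      (hΦ3 m) (hΦN m) (ψ := Φ (m + 1)) (hY' ▸ hΦv (m + 1)) (h0Φ (m + 1))
      (a' := a0 (k₂ + (m + 1)) * ℓ (k₂ + (m + 1)) (Y m) ^ 3) (by have h := hΦ3 (m + 1); rw [hY'] at h; exact h)
      (by have h := hΦN (m + 1); rw [hY'] at h; exact h)
  have RA := fun m (hj : j (k₂ + m) = Y m) (hb : b (k₂ + m) = Pi.single (A m) (b (k₂ + m) (A m)))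
      (hA' : A (m + 1) = Y m) (hB' : B (m + 1) = B m) (hY' : Y (m + 1) = A m) =>
    rotation_step_readings_chain hc hw hr0 hfloor hshade hord hform hdir hlam hprop hcarry (k := k₂ + m) (hk₀m m)
      (hdist m).1 (hdist m).2.1 (hdist m).2.2.1 (hdist m).2.2.2.1 (hdist m).2.2.2.2.1 (hdist m).2.2.2.2.2 (hr m)
      (by have h := hr (m + 1); rw [hA', hB'] at h; exact h) hj hb (hℓY m) (hclean _ (Nat.le_add_right _ _))
      (hbornA m) (hbornB m) (hΦv m) (h0Φ m) (hΦlin m (A m) (hdist m).2.2.1) (hΦ3 m) (hΦN m) (ψ := Φ (m + 1))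
      (hY' ▸ hΦv (m + 1)) (h0Φ (m + 1)) (by have h := hΦ3 (m + 1); rw [hY'] at h; exact h)
      (by have h := hΦN (m + 1); rw [hY'] at h; exact h)
  have RB := fun m (hj : j (k₂ + m) = Y m) (hb : b (k₂ + m) = Pi.single (B m) (b (k₂ + m) (B m)))
      (hA' : A (m + 1) = A m) (hB' : B (m + 1) = Y m) (hY' : Y (m + 1) = B m) =>
    rotation_step_readings_chain hc hw hr0 hfloor hshade hord hform hdir hlam hprop hcarry (k := k₂ + m) (hk₀m m)
      (hdist m).1.symm (hdist m).2.2.2.1 (hdist m).2.2.2.2.1 (hdist m).2.1 (hdist m).2.2.1 (hdist m).2.2.2.2.2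
      (hrBA m) (by have h := hr (m + 1); rw [hA', hB', add_comm (Finsupp.single (A m) 1)] at h; exact h) hj hb
      (hℓY m) (hclean _ (Nat.le_add_right _ _)) (hbornB m) (hbornA m) (hΦv m) (h0Φ m)
      (hΦlin m (B m) (hdist m).2.2.2.2.1) (hΦ3 m) (hΦN m) (ψ := Φ (m + 1)) (hY' ▸ hΦv (m + 1)) (h0Φ (m + 1))
      (by have h := hΦ3 (m + 1); rw [hY'] at h; exact h) (by have h := hΦN (m + 1); rw [hY'] at h; exact h)
  -- `x_A²x_B²` never lies in `S₀` (both legality lists)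
  have hs110 : ∀ m, sR m 1 1 0 = 0 := by
    intro m
    rcases hcls m with ⟨-, hj, hb, hA', hB', hY'⟩ | ⟨-, hj, hb, hA', hB', hY'⟩ | ⟨-, hj, hb, -, hA', hB', hY'⟩ |
      ⟨-, hj, hb, -, hA', hB', hY'⟩
    · simpa only [hsR, htR, hr m, Finsupp.single_zero, add_zero, zero_add, Nat.reduceAdd, @add_comm (Fin 4 →₀ ℕ) _, @add_left_comm (Fin 4 →₀ ℕ) _, @add_assoc (Fin 4 →₀ ℕ) _] using (PA m hj hb hA' hB' hY').1.1
    · simpa only [hsR, htR, hr m, Finsupp.single_zero, add_zero, zero_add, Nat.reduceAdd, @add_comm (Fin 4 →₀ ℕ) _, @add_left_comm (Fin 4 →₀ ℕ) _, @add_assoc (Fin 4 →₀ ℕ) _] using (PB m hj hb hA' hB' hY').1.1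
    · simpa only [hsR, htR, hr m, Finsupp.single_zero, add_zero, zero_add, Nat.reduceAdd, @add_comm (Fin 4 →₀ ℕ) _, @add_left_comm (Fin 4 →₀ ℕ) _, @add_assoc (Fin 4 →₀ ℕ) _] using (RA m hj hb hA' hB' hY').1.1
    · simpa only [hsR, htR, hr m, Finsupp.single_zero, add_zero, zero_add, Nat.reduceAdd, @add_comm (Fin 4 →₀ ℕ) _, @add_left_comm (Fin 4 →₀ ℕ) _, @add_assoc (Fin 4 →₀ ℕ) _] using (RB m hj hb hA' hB' hY').1.1
  -- the game γ₀‴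
  refine no_twoSlot_tail_of_readings_rotating 5 (fun k => (hc k).1) hw (k₁ := k₂) (A := A) (B := B) (L := L)
    (s := sR) (t := tR) ?_ ?_ ?_ ?_ ?_ ?_ ?_ ?_ ?_ ?_ ?_ ?_
  · -- `hA`
    intro m hL
    rcases hcls m with ⟨-, hj, -, hA', -⟩ | ⟨hn, -⟩ | ⟨-, hj, -, -, hA', -⟩ | ⟨hn, -⟩
    · rw [hA', hj]
    · exact absurd hL hn
    · rw [hA', hj]
    · exact absurd hL hn
  · -- `hstepA`
    intro m hL
    rcases hcls m with ⟨-, hj, -⟩ | ⟨hn, -⟩ | ⟨-, -, -, hb0, -⟩ | ⟨hn, -⟩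
    · exact Or.inl hj
    · exact absurd hL hn
    · exact Or.inr hb0
    · exact absurd hL hn
  · -- `hB`
    intro m hL
    rcases hcls m with ⟨hl, -⟩ | ⟨-, hj, -, -, hB', -⟩ | ⟨hl, -⟩ | ⟨-, hj, -, -, -, hB', -⟩
    · exact absurd hl hL
    · rw [hB', hj]
    · exact absurd hl hL
    · rw [hB', hj]
  · -- `hstepB`
    intro m hL
    rcases hcls m with ⟨hl, -⟩ | ⟨-, hj, -⟩ | ⟨hl, -⟩ | ⟨-, -, -, hb0, -⟩
    · exact absurd hl hL
    · exact Or.inl hj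
    · exact absurd hl hL
    · exact Or.inr hb0
  · -- `hfix`
    intro m hL h
    rcases hcls m with ⟨-, hj, hb, hA', hB', hY'⟩ | ⟨hn, -⟩ | ⟨-, hj, hb, -, hA', hB', hY'⟩ | ⟨hn, -⟩
    · left
      have h2 : sR (m + 1) 1 2 0 = sR m 1 2 0 := by
        simpa only [hsR, htR, hr m, hr (m + 1), hA', hB', hY', Finsupp.single_zero, add_zero, zero_add, Nat.reduceAdd, Nat.add_assoc k₂ m 1, @add_comm (Fin 4 →₀ ℕ) _, @add_left_comm (Fin 4 →₀ ℕ) _, @add_assoc (Fin 4 →₀ ℕ) _] using (PA m hj hb hA' hB' hY').2.2.1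
      rwa [h2]
    · exact absurd hL hn
    · have h' := (RA m hj hb hA' hB' hY').2.1 (by simpa only [hsR, htR, hr m, Finsupp.single_zero, add_zero, zero_add, Nat.reduceAdd, @add_comm (Fin 4 →₀ ℕ) _, @add_left_comm (Fin 4 →₀ ℕ) _, @add_assoc (Fin 4 →₀ ℕ) _] using h)
      rcases h' with h' | h' | h'
      · left; simpa only [hsR, htR, hr m, hr (m + 1), hA', hB', hY', Finsupp.single_zero, add_zero, zero_add, Nat.reduceAdd, Nat.add_assoc k₂ m 1, @add_comm (Fin 4 →₀ ℕ) _, @add_left_comm (Fin 4 →₀ ℕ) _, @add_assoc (Fin 4 →₀ ℕ) _] using h'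
      · right; simpa only [hsR, htR, hr m, hr (m + 1), hA', hB', hY', Finsupp.single_zero, add_zero, zero_add, Nat.reduceAdd, Nat.add_assoc k₂ m 1, @add_comm (Fin 4 →₀ ℕ) _, @add_left_comm (Fin 4 →₀ ℕ) _, @add_assoc (Fin 4 →₀ ℕ) _] using h'
      · exact absurd (by simpa only [hsR, htR, hr m, hr (m + 1), hA', hB', hY', Finsupp.single_zero, add_zero, zero_add, Nat.reduceAdd, Nat.add_assoc k₂ m 1, @add_comm (Fin 4 →₀ ℕ) _, @add_left_comm (Fin 4 →₀ ℕ) _, @add_assoc (Fin 4 →₀ ℕ) _] using hs110 (m + 1)) h'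
    · exact absurd hL hn
  · -- `hfix'`
    intro m hL h
    rcases hcls m with ⟨-, hj, hb, hA', hB', hY'⟩ | ⟨hn, -⟩ | ⟨-, hj, hb, -, hA', hB', hY'⟩ | ⟨hn, -⟩
    · have h2 : sR (m + 1) 0 2 0 = sR m 0 2 0 := by
        simpa only [hsR, htR, hr m, hr (m + 1), hA', hB', hY', Finsupp.single_zero, add_zero, zero_add, Nat.reduceAdd, Nat.add_assoc k₂ m 1, @add_comm (Fin 4 →₀ ℕ) _, @add_left_comm (Fin 4 →₀ ℕ) _, @add_assoc (Fin 4 →₀ ℕ) _] using (QA m hj hb hY').1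
      rwa [h2]
    · exact absurd hL hn
    · have h' := (RA m hj hb hA' hB' hY').2.2.1 (by simpa only [hsR, htR, hr m, Finsupp.single_zero, add_zero, zero_add, Nat.reduceAdd, @add_comm (Fin 4 →₀ ℕ) _, @add_left_comm (Fin 4 →₀ ℕ) _, @add_assoc (Fin 4 →₀ ℕ) _] using h)
      simpa only [hsR, htR, hr m, hr (m + 1), hA', hB', hY', Finsupp.single_zero, add_zero, zero_add, Nat.reduceAdd, Nat.add_assoc k₂ m 1, @add_comm (Fin 4 →₀ ℕ) _, @add_left_comm (Fin 4 →₀ ℕ) _, @add_assoc (Fin 4 →₀ ℕ) _] using h'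
    · exact absurd hL hn
  · -- `hmuA`
    intro m hL h
    rcases hcls m with ⟨hl, -⟩ | ⟨-, hj, hb, hA', hB', hY'⟩ | ⟨hl, -⟩ | ⟨-, hj, hb, -, hA', hB', hY'⟩
    · exact absurd hl hL
    · have h2 : sR (m + 1) 1 1 0 = sR m 1 2 0 := by
        simpa only [hsR, htR, hr m, hr (m + 1), hA', hB', hY', Finsupp.single_zero, add_zero, zero_add, Nat.reduceAdd, Nat.add_assoc k₂ m 1, @add_comm (Fin 4 →₀ ℕ) _, @add_left_comm (Fin 4 →₀ ℕ) _, @add_assoc (Fin 4 →₀ ℕ) _] using (PB m hj hb hA' hB' hY').2.2.2.1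
      rwa [h2]
    · exact absurd hl hL
    · have h' := (RB m hj hb hA' hB' hY').2.2.2.1 (by simpa only [hsR, htR, hr m, Finsupp.single_zero, add_zero, zero_add, Nat.reduceAdd, @add_comm (Fin 4 →₀ ℕ) _, @add_left_comm (Fin 4 →₀ ℕ) _, @add_assoc (Fin 4 →₀ ℕ) _] using h)
      simpa only [hsR, htR, hr m, hr (m + 1), hA', hB', hY', Finsupp.single_zero, add_zero, zero_add, Nat.reduceAdd, Nat.add_assoc k₂ m 1, @add_comm (Fin 4 →₀ ℕ) _, @add_left_comm (Fin 4 →₀ ℕ) _, @add_assoc (Fin 4 →₀ ℕ) _] using h'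
  · -- `hmuB`
    intro m hL h
    rcases hcls m with ⟨hl, -⟩ | ⟨-, hj, hb, hA', hB', hY'⟩ | ⟨hl, -⟩ | ⟨-, hj, hb, -, hA', hB', hY'⟩
    · exact absurd hl hL
    · left
      have h2 : sR (m + 1) 1 2 0 = sR m 1 3 0 := by
        simpa only [hsR, htR, hr m, hr (m + 1), hA', hB', hY', Finsupp.single_zero, add_zero, zero_add, Nat.reduceAdd, Nat.add_assoc k₂ m 1, @add_comm (Fin 4 →₀ ℕ) _, @add_left_comm (Fin 4 →₀ ℕ) _, @add_assoc (Fin 4 →₀ ℕ) _] using (PB m hj hb hA' hB' hY').2.2.2.2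
      rwa [h2]
    · exact absurd hl hL
    · have h' := (RB m hj hb hA' hB' hY').2.2.2.2.1 (by simpa only [hsR, htR, hr m, Finsupp.single_zero, add_zero, zero_add, Nat.reduceAdd, @add_comm (Fin 4 →₀ ℕ) _, @add_left_comm (Fin 4 →₀ ℕ) _, @add_assoc (Fin 4 →₀ ℕ) _] using h)
      rcases h' with h' | h' | h'
      · left; simpa only [hsR, htR, hr m, hr (m + 1), hA', hB', hY', Finsupp.single_zero, add_zero, zero_add, Nat.reduceAdd, Nat.add_assoc k₂ m 1, @add_comm (Fin 4 →₀ ℕ) _, @add_left_comm (Fin 4 →₀ ℕ) _, @add_assoc (Fin 4 →₀ ℕ) _] using h'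
      · right; simpa only [hsR, htR, hr m, hr (m + 1), hA', hB', hY', Finsupp.single_zero, add_zero, zero_add, Nat.reduceAdd, Nat.add_assoc k₂ m 1, @add_comm (Fin 4 →₀ ℕ) _, @add_left_comm (Fin 4 →₀ ℕ) _, @add_assoc (Fin 4 →₀ ℕ) _] using h'
      · exact absurd (by simpa only [hsR, htR, hr m, hr (m + 1), hA', hB', hY', Finsupp.single_zero, add_zero, zero_add, Nat.reduceAdd, Nat.add_assoc k₂ m 1, @add_comm (Fin 4 →₀ ℕ) _, @add_left_comm (Fin 4 →₀ ℕ) _, @add_assoc (Fin 4 →₀ ℕ) _] using hs110 (m + 1)) h'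
  · -- `hmuT`
    intro m hL h
    rcases hcls m with ⟨hl, -⟩ | ⟨-, hj, hb, hA', hB', hY'⟩ | ⟨hl, -⟩ | ⟨-, hj, hb, -, hA', hB', hY'⟩
    · exact absurd hl hL
    · have h2 : tR (m + 1) 1 0 0 = tR m 1 0 0 := by
        simpa only [hsR, htR, hr m, hr (m + 1), hA', hB', hY', Finsupp.single_zero, add_zero, zero_add, Nat.reduceAdd, Nat.add_assoc k₂ m 1, @add_comm (Fin 4 →₀ ℕ) _, @add_left_comm (Fin 4 →₀ ℕ) _, @add_assoc (Fin 4 →₀ ℕ) _] using (QB m hj hb hY').2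
      rwa [h2]
    · exact absurd hl hL
    · have h' := (RB m hj hb hA' hB' hY').2.2.2.2.2.1 (by simpa only [hsR, htR, hr m, Finsupp.single_zero, add_zero, zero_add, Nat.reduceAdd, @add_comm (Fin 4 →₀ ℕ) _, @add_left_comm (Fin 4 →₀ ℕ) _, @add_assoc (Fin 4 →₀ ℕ) _] using h)
      simpa only [hsR, htR, hr m, hr (m + 1), hA', hB', hY', Finsupp.single_zero, add_zero, zero_add, Nat.reduceAdd, Nat.add_assoc k₂ m 1, @add_comm (Fin 4 →₀ ℕ) _, @add_left_comm (Fin 4 →₀ ℕ) _, @add_assoc (Fin 4 →₀ ℕ) _] using h'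
  · -- `hlegL`
    intro m hL
    rcases hcls m with ⟨-, hj, hb, hA', hB', hY'⟩ | ⟨hn, -⟩ | ⟨-, hj, hb, -, hA', hB', hY'⟩ | ⟨hn, -⟩
    · obtain ⟨h1, -, -, -, h5⟩ := (PA m hj hb hA' hB' hY').1
      exact ⟨by simpa only [hsR, htR, hr m, Finsupp.single_zero, add_zero, zero_add, Nat.reduceAdd, @add_comm (Fin 4 →₀ ℕ) _, @add_left_comm (Fin 4 →₀ ℕ) _, @add_assoc (Fin 4 →₀ ℕ) _] using h1, by simpa only [hsR, htR, hr m, Finsupp.single_zero, add_zero, zero_add, Nat.reduceAdd, @add_comm (Fin 4 →₀ ℕ) _, @add_left_comm (Fin 4 →₀ ℕ) _, @add_assoc (Fin 4 →₀ ℕ) _] using h5⟩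
    · exact absurd hL hn
    · obtain ⟨h1, -, -, -, h5⟩ := (RA m hj hb hA' hB' hY').1
      exact ⟨by simpa only [hsR, htR, hr m, Finsupp.single_zero, add_zero, zero_add, Nat.reduceAdd, @add_comm (Fin 4 →₀ ℕ) _, @add_left_comm (Fin 4 →₀ ℕ) _, @add_assoc (Fin 4 →₀ ℕ) _] using h1, by simpa only [hsR, htR, hr m, Finsupp.single_zero, add_zero, zero_add, Nat.reduceAdd, @add_comm (Fin 4 →₀ ℕ) _, @add_left_comm (Fin 4 →₀ ℕ) _, @add_assoc (Fin 4 →₀ ℕ) _] using h5⟩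
    · exact absurd hL hn
  · -- `hlegM`
    intro m hL
    rcases hcls m with ⟨hl, -⟩ | ⟨-, hj, hb, hA', hB', hY'⟩ | ⟨hl, -⟩ | ⟨-, hj, hb, -, hA', hB', hY'⟩
    · exact absurd hl hL
    · obtain ⟨-, h2, h3, h4, h5⟩ := (PB m hj hb hA' hB' hY').1
      exact ⟨by simpa only [hsR, htR, hr m, Finsupp.single_zero, add_zero, zero_add, Nat.reduceAdd, @add_comm (Fin 4 →₀ ℕ) _, @add_left_comm (Fin 4 →₀ ℕ) _, @add_assoc (Fin 4 →₀ ℕ) _] using h2, hs110 m, by simpa only [hsR, htR, hr m, Finsupp.single_zero, add_zero, zero_add, Nat.reduceAdd, @add_comm (Fin 4 →₀ ℕ) _, @add_left_comm (Fin 4 →₀ ℕ) _, @add_assoc (Fin 4 →₀ ℕ) _] using h3, by simpa only [hsR, htR, hr m, Finsupp.single_zero, add_zero, zero_add, Nat.reduceAdd, @add_comm (Fin 4 →₀ ℕ) _, @add_left_comm (Fin 4 →₀ ℕ) _, @add_assoc (Fin 4 →₀ ℕ) _] using h5,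
        by simpa only [hsR, htR, hr m, Finsupp.single_zero, add_zero, zero_add, Nat.reduceAdd, @add_comm (Fin 4 →₀ ℕ) _, @add_left_comm (Fin 4 →₀ ℕ) _, @add_assoc (Fin 4 →₀ ℕ) _] using h4⟩
    · exact absurd hl hL
    · obtain ⟨-, h2, h3, h4, h5⟩ := (RB m hj hb hA' hB' hY').1
      exact ⟨by simpa only [hsR, htR, hr m, Finsupp.single_zero, add_zero, zero_add, Nat.reduceAdd, @add_comm (Fin 4 →₀ ℕ) _, @add_left_comm (Fin 4 →₀ ℕ) _, @add_assoc (Fin 4 →₀ ℕ) _] using h2, hs110 m, by simpa only [hsR, htR, hr m, Finsupp.single_zero, add_zero, zero_add, Nat.reduceAdd, @add_comm (Fin 4 →₀ ℕ) _, @add_left_comm (Fin 4 →₀ ℕ) _, @add_assoc (Fin 4 →₀ ℕ) _] using h3, by simpa only [hsR, htR, hr m, Finsupp.single_zero, add_zero, zero_add, Nat.reduceAdd, @add_comm (Fin 4 →₀ ℕ) _, @add_left_comm (Fin 4 →₀ ℕ) _, @add_assoc (Fin 4 →₀ ℕ) _] using h5,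
        by simpa only [hsR, htR, hr m, Finsupp.single_zero, add_zero, zero_add, Nat.reduceAdd, @add_comm (Fin 4 →₀ ℕ) _, @add_left_comm (Fin 4 →₀ ℕ) _, @add_assoc (Fin 4 →₀ ℕ) _] using h4⟩
  · -- `hflag`
    intro m hL
    rcases hcls m with ⟨-, hj, hb, hA', hB', hY'⟩ | ⟨hn, -⟩ | ⟨-, hj, hb, -, hA', hB', hY'⟩ | ⟨hn, -⟩
    · rcases (PA m hj hb hA' hB' hY').2.1 with h | h | h | h | h | h
      · exact Or.inl (by simpa only [hsR, htR, hr m, hr (m + 1), hA', hB', hY', Finsupp.single_zero, add_zero, zero_add, Nat.reduceAdd, Nat.add_assoc k₂ m 1, @add_comm (Fin 4 →₀ ℕ) _, @add_left_comm (Fin 4 →₀ ℕ) _, @add_assoc (Fin 4 →₀ ℕ) _] using h)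
      · exact Or.inr (Or.inl (by simpa only [hsR, htR, hr m, hr (m + 1), hA', hB', hY', Finsupp.single_zero, add_zero, zero_add, Nat.reduceAdd, Nat.add_assoc k₂ m 1, @add_comm (Fin 4 →₀ ℕ) _, @add_left_comm (Fin 4 →₀ ℕ) _, @add_assoc (Fin 4 →₀ ℕ) _] using h))
      · exact Or.inr (Or.inr (Or.inl (by simpa only [hsR, htR, hr m, hr (m + 1), hA', hB', hY', Finsupp.single_zero, add_zero, zero_add, Nat.reduceAdd, Nat.add_assoc k₂ m 1, @add_comm (Fin 4 →₀ ℕ) _, @add_left_comm (Fin 4 →₀ ℕ) _, @add_assoc (Fin 4 →₀ ℕ) _] using h)))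
      · exact Or.inr (Or.inr (Or.inr (Or.inl (by simpa only [hsR, htR, hr m, hr (m + 1), hA', hB', hY', Finsupp.single_zero, add_zero, zero_add, Nat.reduceAdd, Nat.add_assoc k₂ m 1, @add_comm (Fin 4 →₀ ℕ) _, @add_left_comm (Fin 4 →₀ ℕ) _, @add_assoc (Fin 4 →₀ ℕ) _] using h))))
      · exact Or.inr (Or.inr (Or.inr (Or.inr (Or.inl (by simpa only [hsR, htR, hr m, hr (m + 1), hA', hB', hY', Finsupp.single_zero, add_zero, zero_add, Nat.reduceAdd, Nat.add_assoc k₂ m 1, @add_comm (Fin 4 →₀ ℕ) _, @add_left_comm (Fin 4 →₀ ℕ) _, @add_assoc (Fin 4 →₀ ℕ) _] using h)))))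
      · exact Or.inr (Or.inr (Or.inr (Or.inr (Or.inr (Or.inl (by simpa only [hsR, htR, hr m, hr (m + 1), hA', hB', hY', Finsupp.single_zero, add_zero, zero_add, Nat.reduceAdd, Nat.add_assoc k₂ m 1, @add_comm (Fin 4 →₀ ℕ) _, @add_left_comm (Fin 4 →₀ ℕ) _, @add_assoc (Fin 4 →₀ ℕ) _] using h))))))
    · exact absurd hL hn
    · rcases (RA m hj hb hA' hB' hY').2.2.2.2.2.2 with h | h | h | h | h | h | h | h
      · exact Or.inl (by simpa only [hsR, htR, hr m, hr (m + 1), hA', hB', hY', Finsupp.single_zero, add_zero, zero_add, Nat.reduceAdd, Nat.add_assoc k₂ m 1, @add_comm (Fin 4 →₀ ℕ) _, @add_left_comm (Fin 4 →₀ ℕ) _, @add_assoc (Fin 4 →₀ ℕ) _] using h)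
      · exact Or.inr (Or.inl (by simpa only [hsR, htR, hr m, hr (m + 1), hA', hB', hY', Finsupp.single_zero, add_zero, zero_add, Nat.reduceAdd, Nat.add_assoc k₂ m 1, @add_comm (Fin 4 →₀ ℕ) _, @add_left_comm (Fin 4 →₀ ℕ) _, @add_assoc (Fin 4 →₀ ℕ) _] using h))
      · exact Or.inr (Or.inr (Or.inl (by simpa only [hsR, htR, hr m, hr (m + 1), hA', hB', hY', Finsupp.single_zero, add_zero, zero_add, Nat.reduceAdd, Nat.add_assoc k₂ m 1, @add_comm (Fin 4 →₀ ℕ) _, @add_left_comm (Fin 4 →₀ ℕ) _, @add_assoc (Fin 4 →₀ ℕ) _] using h)))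
      · exact Or.inr (Or.inr (Or.inr (Or.inl (by simpa only [hsR, htR, hr m, hr (m + 1), hA', hB', hY', Finsupp.single_zero, add_zero, zero_add, Nat.reduceAdd, Nat.add_assoc k₂ m 1, @add_comm (Fin 4 →₀ ℕ) _, @add_left_comm (Fin 4 →₀ ℕ) _, @add_assoc (Fin 4 →₀ ℕ) _] using h))))
      · exact Or.inr (Or.inr (Or.inr (Or.inr (Or.inl (by simpa only [hsR, htR, hr m, hr (m + 1), hA', hB', hY', Finsupp.single_zero, add_zero, zero_add, Nat.reduceAdd, Nat.add_assoc k₂ m 1, @add_comm (Fin 4 →₀ ℕ) _, @add_left_comm (Fin 4 →₀ ℕ) _, @add_assoc (Fin 4 →₀ ℕ) _] using h)))))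
      · exact Or.inr (Or.inr (Or.inr (Or.inr (Or.inr (Or.inl (by simpa only [hsR, htR, hr m, hr (m + 1), hA', hB', hY', Finsupp.single_zero, add_zero, zero_add, Nat.reduceAdd, Nat.add_assoc k₂ m 1, @add_comm (Fin 4 →₀ ℕ) _, @add_left_comm (Fin 4 →₀ ℕ) _, @add_assoc (Fin 4 →₀ ℕ) _] using h))))))
      · exact Or.inr (Or.inr (Or.inr (Or.inr (Or.inr (Or.inr (Or.inl (by simpa only [hsR, htR, hr m, hr (m + 1), hA', hB', hY', Finsupp.single_zero, add_zero, zero_add, Nat.reduceAdd, Nat.add_assoc k₂ m 1, @add_comm (Fin 4 →₀ ℕ) _, @add_left_comm (Fin 4 →₀ ℕ) _, @add_assoc (Fin 4 →₀ ℕ) _] using h)))))))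
      · exact Or.inr (Or.inr (Or.inr (Or.inr (Or.inr (Or.inr (Or.inr (by simpa only [hsR, htR, hr m, hr (m + 1), hA', hB', hY', Finsupp.single_zero, add_zero, zero_add, Nat.reduceAdd, Nat.add_assoc k₂ m 1, @add_comm (Fin 4 →₀ ℕ) _, @add_left_comm (Fin 4 →₀ ℕ) _, @add_assoc (Fin 4 →₀ ℕ) _] using h)))))))
    · exact absurd hL hn

/-! ## K27a's light `d = 3` tail, unconditional -/

/-- **THE LIGHT `d = 3` TAIL AT `p = 5` IS EMPTY — UNCONDITIONAL** (K27a `no_light_powerCone_tail_three_five_of`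
with its by-value hypothesis `hT2` discharged by `no_twoSlot_tail_five`): a witnessed isolated above-floor `Step0 5`
chain with `x^{r₀} ∣ F₀` cannot have shade `3` and `e_G = 3` from any stage on.  (T1) free tail and (T3) triple
regime are K27a's; (T2) is `no_twoSlot_tail_five`. [OURS] [cite: CossartJannsenSaito2020, Thm. 3.10(4), Thm. 3.14, Thm. 9.3] -/
theorem no_light_powerCone_tail_three_five {c : ℕ → State K} {j : ℕ → Fin 4} {b : ℕ → Fin 4 → K}
    (hc : ∀ k, IsIsolated 5 (c k).F ∧ Step0 5 (c k) (c (k + 1))) (hw : FreeTail.IsWitnessedChain 5 c j b)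
    (hr0 : ∀ e ∈ (c 0).F.support, (c 0).r ≤ e) (hfloor : ∀ k, ordZero (c k).F ≠ (5 : ℕ)) {k₀ : ℕ}
    (hshade : ∀ k, k₀ ≤ k → (c k).shade = ((3 : ℕ) : ℕ∞))
    (he3 : ∀ k, k₀ ≤ k → Module.finrank K (resVertex (c k)) = 3) : False :=
  no_light_powerCone_tail_three_five_of hc hw hr0 hfloor hshade he3 fun _ _ hk₁ hidle hborn =>
    no_twoSlot_tail_five hc hw hr0 hfloor hshade he3 hk₁ hidle hborn

/-- **THE RESIDUAL `hslotT` OF RECORD HOLDS** (vacuously, by `no_twoSlot_tail_five`): the by-value hypothesis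
`hslotT` of res-dim4-p-2's `no_twoSlot_tail_five_of_slotT` / `no_light_powerCone_tail_three_five_of_slotT` and of
res-dim4-p-3's `noAboveFloorTrap_five_iff_residual_of_slotT`, `…_two_of_rotation` and K27c
`noAboveFloorTrap_five_iff_sliceC_of_rotation` — «a (T2) tail in the T-sector at `k₁` takes no rotation step from `k₁`
on» — stated for every field of characteristic `5`, so those theorems lose `hslotT` by application. [OURS]
[cite: CossartJannsenSaito2020, Thm. 3.14] -/
theorem twoSlot_slotT_residual : ∀ (K : Type) [Field K] [CharP K 5] [DecidableEq K] (c : ℕ → State K)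
    (j : ℕ → Fin 4) (b : ℕ → Fin 4 → K), (∀ k, IsIsolated 5 (c k).F ∧ Step0 5 (c k) (c (k + 1))) →
    FreeTail.IsWitnessedChain 5 c j b → (∀ e ∈ (c 0).F.support, (c 0).r ≤ e) →
    (∀ k, ordZero (c k).F ≠ (5 : ℕ)) → ∀ k₀ : ℕ, (∀ k, k₀ ≤ k → (c k).shade = ((3 : ℕ) : ℕ∞)) →
    (∀ k, k₀ ≤ k → Module.finrank K (resVertex (c k)) = 3) →
    ∀ (ν : Fin 4) (k₁ : ℕ), k₀ ≤ k₁ → (∀ k, k₁ ≤ k → 1 ≤ (c k).r ν ∧ j k ≠ ν ∧ b k ν = 0) →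
    (∀ k, k₁ ≤ k → ∀ i, i ≠ ν → 1 ≤ (c k).r i →
      ∃ t, k₀ ≤ t ∧ t < k ∧ j t = i ∧ ∀ m, t < m → m < k → j m ≠ i ∧ b m i = 0) →
    (∀ ℓ : Fin 4 → K, (∀ w, w ∈ resVertex (c k₁) ↔ dotProduct ℓ w = 0) →
      ∀ i, (c k₁).r i = 0 → ℓ i ≠ 0) → ∀ k, k₁ ≤ k → 1 ≤ (c k).r (j k) :=
  fun _ _ _ _ _ _ _ hc hw hr0 hfloor _ hshade he3 _ _ hk₁ hidle hborn _ _ _ =>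
    (no_twoSlot_tail_five hc hw hr0 hfloor hshade he3 hk₁ hidle hborn).elim

end Tail

end ResCone

end Summit.ResolutionOfSingularities.ResolutionOfSingularities.Theorems.PIDim4

end
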